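import Literature.MathematicalPhysics.QuantumFieldTheory.Balaban1983to89.B15Prop1GradientFromNearValue
import Literature.MathematicalPhysics.QuantumFieldTheory.Balaban1983to89.B15Prop1IntrinsicAtCoPRecord
import Literature.MathematicalPhysics.QuantumFieldTheory.Balaban1983to89.B10Eq5RegularAction

/-!
# `Balaban1983to89.B15Prop1GradientFromNearValueAtCoPRecord` — [Balaban1989LargeFieldI] Prop. 1 p. 194 / [Balaban1989LargeFieldII] pp. 357–359: ★★★
# PROPOSITION 1 [IV] WITH ITS ANALYTIC-EXTENSION CLAUSE AT THE v1.5 BACKGROUND OF RECORD `Node00.bgMSCoPOfRecord F 2 ν K k Ω`, FROM (J1), (L2) AND THE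
# NEAR-FIELD VALUE LETTER (Vn) — the record-13-`CoP` twin of `B15Prop1GradientFromNearValue.…_ofRecord_ofNearValue`

Honest framing: statement-level skeleton of published theorems with citation tags; proofs where landed; nothing here is a claim about
the Yang–Mills mass gap.

Cell pub-ymgap, HUMAN RULING D-0062 (Track A full width), seat `pub-ymgap-dag-n12-c` (R134 acceleration seat (a), strategy s1 of DAG node N12 = [B15];
generation g9).  This is the record-13-`CoP` twin of `B15Prop1GradientFromNearValue.…_ofRecord_ofNearValue`, exactly as
`B15Prop1GradientFromValueAtCoPRecord` (p534598) is the twin of `B15Prop1GradientFromValue.…_ofRecord_ofValue` (p533015).  It SUPERSEDES p534598 for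
consumption: p534598's order-zero letter (V) — the TOTAL value `A(U_{k,Z}(ext V_k)) ≤ cA·ε²` of the typed (1.77) — carries the far-field term of the
typed total action (LOCATED-FARFIELD, module docstring of `B15Prop1GradientFromNearValue`) and is undischargeable at data rough off `Z`; the letter (Vn)
here asks the NEAR-FIELD value only (plaquettes with a corner in `Ω₁(Z) = maxDomT M₁ Z 1`), print's p. 193 ll. 17–20 on `Z` summed.

TYPING (instance hygiene — the reason this is its own module, as for p529759 ∕ p534598).  The NODE 00 record modules carry the global instance
`B6Prop26ReachTransplant.instDecidableEqPBond`, while the N12∕s1 chain states the slice objects over the CLASSICAL instance.  DEVICE (no attribute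
touched, no instance declared): the bond-decidability is bound as an instance-implicit family `[hdec : ∀ j, DecidableEq (PBond (F.P K) j)]` with the
propositional pin `hcl : hdec = fun _ a b => Classical.propDecidable (a = b)` (a consumer discharges it by `Subsingleton.elim _ _`); the proof substitutes
`hcl` and applies `B15Prop1GradientFromNearValue.exists_domain_prop1Printed_lfVarOn_std_su2_box_intrinsic_analytic_ofRecord_ofNearValue` verbatim.

WHAT THIS FILE PROVES (no `sorry`, no definition, no `… : Prop` fact; axioms standard): §0 ★ `far_letter_of_box` — the geometric letter `hfar` from the box
geometry of the chain (`hbox`) and ONE inclusion «the k-blocks of the box enlarged by one layer lie in `Ω₁(Z)`»; §0b ★ `two_le_fun177std_of_far_antipodal`,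
★ `not_solvable_of_valueLetter` — the KERNEL CERTIFICATE of LOCATED-FARFIELD (a solvable datum with one far plaquette of `Re tr = −1` has typed (1.77) value
`≥ 2`; hence p533015∕p534598's total-value letter forces unsolvability at every datum regular near `Z` but rough off it); §0c `nearValue_le_of_plaqSmallOn` —
print's regularity (8) on the near plaquettes gives (Vn) with `cA = ½c²·#plaqsOf Ω₁(Z)` (`1 − Re tr ≤ ½|· − 1|²`); §1 ★★★
`exists_domain_prop1Printed_lfVarOn_std_su2_box_intrinsic_analytic_atCoPRecord_ofNearValue` — `∃ a₁ > 0, B15.Prop1Printed (lfVarOn su2Chart fun i =>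
InstOn.std (Node00.bgMSCoPOfRecord F 2 ν K k Ω) M₁ (Z i) (Λ i) (k i) (M i) (a₁ i) (anExt … (rA i)))` from (J1) `hGj`, (L2) `hlead` + `hsm`∕`hγle`, (Vn) `hVn`
(the near-field value `Σ_{p ∈ plaqsOf Ω₁(Z)} (1 − Re tr U_{k,Z}(ext V_k)(∂p)) ≤ cA·ε²` at `ε`-regular data), the geometric letter `hfar` («the k-blocks over
the bonds meeting `Λ^{(k)}` lie inside `Ω₁(Z)`»), `0 < k i ≤ m + K`, the bookkeeping `hcJ'`, structure, and the instance pin `hcl`.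

HONEST SCOPE.  Count-neutral; (J1)∕(L2) are NODE 00's ([15] Thm 1 ∕ Prop. 9; [IV] p. 193; [LF-II] pp. 357–359) and (Vn) is NODE 00's regularity of
`U_{k,Z}` on `Z` ([IV] p. 193 ll. 17–20, [15] Thm 1 (8) p. 279) summed over the near plaquettes — NOT proved here; the constant `4𝓐∕(R·eR)` carries the
polydisc bound of the typed total function; NOT a discharge of N12; nothing continuum ∕ OS ∕ mass-gap ∕ Clay.
-/

noncomputable section

open Set Finset Metric
open scoped BigOperators Matrix RealInnerProductSpace Real InnerProductSpace

namespace Literature.MathematicalPhysics.QuantumFieldTheory.Balaban1983to89.B15Prop1GradientFromNearValueAtCoPRecord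

open B15DeterminingSets GaugeField B16Sect1Backgrounds B15Prop1Carrier B8Eq17ClassAkV1
open B15Prop1SliceTaylorCalculus B15Prop1LocalLettersOfFun B15Prop1IntrinsicOfFun B15Prop1IntrinsicOfRecord B15Prop1GradientFromNearValue
open B15Prop1AnalyticExtClause (cplxVec cplxSlice anExt)
open B15Prop1ChartCalculusSU2 (E3)
open T4CubeChartGnomonic (SU2)
open B15Prop1ChartSU2 (su2Chart)
open B15Prop1SliceCoordinates (GaugeSlice ιA freeBonds)
open T4AxialGaugeSmallField (castSite boxPlaqs castSite_add_e)
open B7Prop1Explicit (e e_apply)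
open B6BondElimination (unitVec)
open B16Eq18Proof (box)
open B15Extension193 (extend)
open B15ShellGauge193 (shellGauge)
open B5Bounds167Lattice (formDk ofRealCfg)
open B14.Eq213DetSet B14.Eq216Concrete B15Sect1Instances B15Eq177GaugeInvariance B15Eq177ValueInvariance B15Eq177ValueInvarianceCoDiv B16Sect1Wilson
open B14.Eq22Determines (blockIter)
open Literature.MathematicalPhysics.QuantumFieldTheory.BalabanImbrieJaffe1984to88.BIJ85Eq453GaugeField
open T4Continuum

/-! ## §0 The geometric letter `hfar` from the box geometry of the chain -/

section Geometry

variable {P : Params}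

/-- `x ↦ x + e_μ` is injective on every torus of the series. [folklore] -/
private theorem shift_injective {j : ℕ} (μ : Fin P.d) : Function.Injective fun x : Site P j => x.shift μ := by
  intro x y h
  funext ν
  have hν := congrFun h ν
  by_cases hm : ν = μ
  · subst hm
    simpa [Site.shift, Function.update_self] using hν
  · simpa [Site.shift, Function.update_of_ne hm] using hν

/-- ★ **THE GEOMETRIC LETTER `hfar` FROM THE BOX GEOMETRY OF THE CHAIN.**  If `Λ^{(k)}` is the box `[lo, hi]` (`hbox`, as in every endpoint of the
chain) and every fine site whose `k`-block label lies in that box ENLARGED BY ONE LAYER lies in `Ω₁(Z) = maxDomT M₁ Z 1` (`hZ1`; for a bounded `Z` two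
layers of `LM₁`-cubes inside `Z` suffice, `B14.Eq213DetSet.image_innerN_two_subset_maxDomT` — print's regime `Λ ⊂⊂ Z`, [IV] p. 192–193), then no fine
bond starting outside `Ω₁(Z)` is read, through `Q_k^{s*}`, by a bond meeting `Λ^{(k)}`: the letter `hfar` of
`B15Prop1GradientFromNearValue.…_ofRecord_ofNearValue`. [cite: Balaban1988Convergent, (1.3) p.246, (2.13) pp.256–257; Balaban1989LargeFieldI, (1.74) p.192] -/
theorem far_letter_of_box {M₁ : ℕ} {Z Λ : Set (Site P 0)} {k : ℕ} {lo hi : Fin P.d → ℤ}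
    (hbox : pts k Λ = (castSite '' Set.Icc lo hi : Set (Site P k)))
    (hZ1 : ∀ y : Site P 0, blockIter k y ∈ (castSite '' Set.Icc (lo - 1) (hi + 1) : Set (Site P k)) → y ∈ maxDomT M₁ Z 1)
    (b : PBond P 0) (hb : b.src ∉ maxDomT M₁ Z 1) : (⟨blockIter k b.src, b.dir⟩ : PBond P k) ∉ bondsOf (pts k Λ) := by
  intro hmem
  apply hb
  apply hZ1
  rcases hmem with h | h
  · -- the source `B^k(b₋)` lies in the box
    change blockIter k b.src ∈ pts k Λ at h
    rw [hbox] at h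
    obtain ⟨v, hv, hvx⟩ := h
    refine ⟨v, ⟨fun κ => ?_, fun κ => ?_⟩, hvx⟩
    · have := hv.1 κ
      simp only [Pi.sub_apply, Pi.one_apply]
      linarith
    · have := hv.2 κ
      simp only [Pi.add_apply, Pi.one_apply]
      linarith
  · -- the target `B^k(b₋) + e_μ` lies in the box, so the source is `castSite (v − e_μ)`
    change (blockIter k b.src).shift b.dir ∈ pts k Λ at h
    rw [hbox] at h
    obtain ⟨v, hv, hvx⟩ := h
    refine ⟨v - e b.dir, ⟨fun κ => ?_, fun κ => ?_⟩, ?_⟩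
    · have := hv.1 κ
      simp only [Pi.sub_apply, Pi.one_apply, e_apply]
      split_ifs <;> linarith
    · have := hv.2 κ
      simp only [Pi.sub_apply, Pi.add_apply, Pi.one_apply, e_apply]
      split_ifs <;> linarith
    · apply shift_injective b.dir
      show (castSite (v - e b.dir) : Site P k).shift b.dir = (blockIter k b.src).shift b.dir
      rw [← castSite_add_e, sub_add_cancel, hvx]

end Geometry

/-! ## §0b Kernel certificate of LOCATED-FARFIELD: the total-value letter (V) forces unsolvability at data rough off `Z` -/

section Certificate

open Classical

variable {P : Params}

/-- ★ **KERNEL CERTIFICATE OF LOCATED-FARFIELD.**  At NODE 00's solution map of record (`bg := Node00.bgOfRecord av reg`, `0 < k`): if the (1.74)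
problem at the datum `V` is solvable and some plaquette WITHOUT a corner in `Ω₁(Z) = maxDomT M₁ Z 1` carries a pull-back holonomy with `Re tr = −1`,
then the typed (1.77) value is at least `2` — the far-field term of the TOTAL Wilson action (`Setup.wilsonAction4` sums over every plaquette of the
torus; the minimiser is pinned to `Q_k^{s*}V` there, `B15Prop1GradientFromNearValue.isMinimizer_pinned`).  Print's (1.77) is the action over the
component of `Z` only ([IV] p. 192, [15] (5)). [cite: Balaban1989LargeFieldI, (1.74) p.192, (1.77) p.194; Balaban1985Variational, (5) p.278;
Balaban1988Convergent, (2.12)–(2.13) p.256–257] -/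
theorem two_le_fun177std_of_far_antipodal (av : ∀ j, Averaging P j SU2) (reg : Set (GaugeField P 0 SU2)) (M₁ : ℕ) {Z : Set (Site P 0)}
    {k : ℕ} (hk0 : 0 < k) (V : GaugeField P k SU2)
    (hsol : ∃ U₀, IsMinimizer av reg (Bj M₁ Z k) (avgFamily av (qsstarGIter0 k V)) U₀)
    {p : Plaq P 0} (hp : p ∉ plaqsOf (maxDomT M₁ Z 1)) (hanti : reTr (plaqHol (qsstarGIter0 k V) p) = -1) :
    2 ≤ fun177std (Node00.bgOfRecord av reg) M₁ Z k V := by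
  have hmin := Node00.isMinimizer_UminOfRecord av reg hsol
  have hU : bgKZstd (Node00.bgOfRecord av reg) M₁ Z k V = Node00.UminOfRecord av reg (Bj M₁ Z k) (avgFamily av (qsstarGIter0 k V)) := by
    rw [bgKZstd_apply, Node00.bgOfRecord_U]
  have hpin : plaqHol (Node00.UminOfRecord av reg (Bj M₁ Z k) (avgFamily av (qsstarGIter0 k V))) p = plaqHol (qsstarGIter0 k V) p :=
    plaqHol_congr_of_not_mem_plaqsOf (fun b hb => isMinimizer_pinned hk0 hmin b hb) hp
  rw [fun177std_eq, hU]
  unfold wilsonAction4 wilsonAction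
  have hnn : ∀ q ∈ (Finset.univ : Finset (Plaq P 0)),
      0 ≤ 1 * (1 - reTr (plaqHol (Node00.UminOfRecord av reg (Bj M₁ Z k) (avgFamily av (qsstarGIter0 k V))) q)) := fun q _ => by
    have := GaugeGroup.reTr_le_one (plaqHol (Node00.UminOfRecord av reg (Bj M₁ Z k) (avgFamily av (qsstarGIter0 k V))) q)
    linarith
  have hle := Finset.single_le_sum hnn (Finset.mem_univ p)
  rw [hpin, hanti] at hle
  linarith

/-- ★ **HENCE THE TOTAL-VALUE LETTER (V) OF `B15Prop1GradientFromValue` IS UNDISCHARGEABLE AT PRINT-LIKE DATA**: in the shape p533015∕p534598 ask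
it (at one family member: `∀ ε V_k, 0 < ε ≤ eR → V_k ε-regular on Z ∩ Λᶜ → A(U_{k,Z}(ext V_k)) ≤ cA·ε²`), it forces the (1.74) problem to be
UNSOLVABLE at every extended datum that is `ε`-regular near `Z` (`cA·ε² < 2`) but has one far plaquette with `Re tr = −1` — regularity AWAY from
`Z` is exactly what print's data lack ([IV] p. 177: `Z` is a union of large-field components; the field off `Z` is unrestricted).  The repaired
letter (Vn) of `B15Prop1GradientFromNearValue` reads the near plaquettes only. [cite: Balaban1989LargeFieldI, p.177, (1.77) p.194;
Balaban1988Convergent, (2.12) p.256] -/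
theorem not_solvable_of_valueLetter (av : ∀ j, Averaging P j SU2) (reg : Set (GaugeField P 0 SU2)) (M₁ : ℕ) {Z Λ : Set (Site P 0)}
    {k : ℕ} (hk0 : 0 < k) (ext : GaugeField P k SU2 → GaugeField P k SU2) {eR cA ε : ℝ}
    (hV : ∀ (ε : ℝ) (Vk : GaugeField P k SU2), 0 < ε → ε ≤ eR → PlaqSmallOn (plaqsInside (pts k (Z ∩ Λᶜ))) ε Vk →
      fun177std (Node00.bgOfRecord av reg) M₁ Z k (ext Vk) ≤ cA * ε ^ 2)
    (hε : 0 < ε) (hεR : ε ≤ eR) (hsmall : cA * ε ^ 2 < 2) (Vk : GaugeField P k SU2)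
    (hreg : PlaqSmallOn (plaqsInside (pts k (Z ∩ Λᶜ))) ε Vk)
    {p : Plaq P 0} (hp : p ∉ plaqsOf (maxDomT M₁ Z 1)) (hanti : reTr (plaqHol (qsstarGIter0 k (ext Vk)) p) = -1) :
    ¬ ∃ U₀, IsMinimizer av reg (Bj M₁ Z k) (avgFamily av (qsstarGIter0 k (ext Vk))) U₀ := fun hsol => by
  have h2 := two_le_fun177std_of_far_antipodal av reg M₁ hk0 (ext Vk) hsol hp hanti
  have h1 := hV ε Vk hε hεR hreg
  linarith

end Certificate

/-! ## §0c From print's regularity (8) on the near plaquettes to the near value (Vn) -/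

section NearValue

open Classical

variable {P : Params}

/-- **FROM PRINT'S REGULARITY ON THE NEAR PLAQUETTES TO THE NEAR VALUE LETTER (Vn).**  If `|U(∂p) − 1| < δ` on the plaquettes meeting a site set `Y`
(`0 ≤ δ`; print: [IV] p. 193 ll. 17–20 *«|∂U_{k,Z} − 1| < O(1)B₃M²εη²»*, [15] Thm 1 (8)), then the localized Wilson action at the indicator weight of
`plaqsOf Y` is at most `½δ² · #plaqsOf Y` — each term `1 − Re tr U(∂p) ≤ ½|U(∂p) − 1|²` on `SU(2)` (`B10Eq5RegularAction.one_sub_reTr_le_specialUnitaryGroup`,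
[Balaban1985UV3] (11)) and `B16Sect1Wilson.wilsonLoc_le_card_mul`.  With `Y = Ω₁(Z)`, `U = U_{k,Z}(ext V_k)`, `δ = c·ε` this is the letter `hVn` of §1
with `cA = ½c² · #plaqsOf Ω₁(Z)`. [cite: Balaban1989LargeFieldI, p.193; Balaban1985Variational, Thm 1 (8) p.279; Balaban1985UV3, (11) p.258] -/
theorem nearValue_le_of_plaqSmallOn {j : ℕ} (Y : Set (Site P j)) {δ : ℝ} (hδ : 0 ≤ δ) (U : GaugeField P j SU2)
    (h8 : PlaqSmallOn (plaqsOf Y) δ U) :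
    wilsonLoc ((plaqsOf Y).indicator fun _ => (1 : ℝ)) U ≤ 1 / 2 * δ ^ 2 * ((Finset.univ.filter fun p => p ∈ plaqsOf Y).card : ℝ) := by
  refine wilsonLoc_le_card_mul _ U (Finset.univ.filter fun p => p ∈ plaqsOf Y) (1 / 2 * δ ^ 2) (fun p => ?_) (fun p hp => ?_)
    (fun p hp => ?_)
  · by_cases hm : p ∈ plaqsOf Y
    · simp only [Set.indicator_of_mem hm, le_refl]
    · simp only [Set.indicator_of_notMem hm, zero_le_one]
  · have hm : p ∉ plaqsOf Y := fun h => hp (Finset.mem_filter.2 ⟨Finset.mem_univ _, h⟩)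
    simp only [Set.indicator_of_notMem hm]
  · have hm : p ∈ plaqsOf Y := (Finset.mem_filter.1 hp).2
    have h1 := B10Eq5RegularAction.one_sub_reTr_le_specialUnitaryGroup (plaqHol U p)
    have h2 : dist1 (plaqHol U p) < δ := h8 p hm
    have h0 := GaugeGroup.dist1_nonneg (plaqHol U p)
    have h3 : dist1 (plaqHol U p) ^ 2 ≤ δ ^ 2 := by nlinarith
    calc 1 - reTr (plaqHol U p) ≤ 1 / 2 * dist1 (plaqHol U p) ^ 2 := h1
      _ ≤ 1 / 2 * δ ^ 2 := by nlinarith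

end NearValue

/-! ## §1 At the v1.5 background of record `Node00.bgMSCoPOfRecord F 2 ν K k Ω`: Proposition 1 from (J1), (L2), (Vn) -/

section Record

open Classical

/-- ★★★ **PROPOSITION 1 [IV] WITH ITS ANALYTIC-EXTENSION CLAUSE AT THE v1.5 BACKGROUND OF RECORD `bgMSCoPOfRecord F 2 ν K k Ω`, WITH THE GRADIENT LETTER
(L3) REPLACED BY THE NEAR-FIELD VALUE LETTER (Vn)** (`SU(2)`; the class `regMSCoPOfRecord` = [15] (2) = [6] (1.7) ∧ (1.9) on the support of record):
the record corollary `B15Prop1GradientFromNearValue.exists_domain_prop1Printed_lfVarOn_std_su2_box_intrinsic_analytic_ofRecord_ofNearValue` with the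
class invariance DISCHARGED (`B15Eq177ValueInvarianceCoDiv.gaugeAct_mem_regMSCoPOfRecord`, [15] p. 278 «the spaces … are invariant»).  WHAT A CONSUMER
SUPPLIES: (J1) `hGj`, (L2) `hlead` + `hsm`∕`hγle`, (Vn) `hVn : Σ_{p ∈ plaqsOf Ω₁(Z)} (1 − Re tr U_{k,Z}(ext V_k)(∂p)) ≤ cA·ε²` at `ε`-regular data +
`hcJ' : 2cA·eR∕R + 4𝓐∕(R·eR) ≤ cJ`, the geometric letter `hfar`, `0 < k i ≤ m + K`, the structural box∕margin∕constant hypotheses and the instance pin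
`hcl := Subsingleton.elim _ _` — nothing else; the far field of the typed (1.77) is split off by proof (`B15Prop1GradientFromNearValue.fun177std_dichotomy`).
[cite: Balaban1989LargeFieldI, Prop. 1 (1.77)–(1.78) p.194 (incl. the last clause), p.193, (1.74) p.192; Balaban1989LargeFieldII, (1.7)–(1.9) p.358, (1.11)
p.358, (1.12)–(1.13) p.359; Balaban1985Variational, (2) p.278, (5) p.278, Thm 1 (8) p.279, Prop. 9 p.309] -/
theorem exists_domain_prop1Printed_lfVarOn_std_su2_box_intrinsic_analytic_atCoPRecord_ofNearValue {F : T4Family} (ν : Node00.Stage7Numerics)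
    (Kt kr : ℕ) (Ω : ℕ → Set (Site (F.P Kt) 0)) (hd3 : 3 ≤ (F.P Kt).d) (h0 : 0 < (F.P Kt).d) {ι : Type}
    -- bond decidability: the consumer's instance, pinned propositionally to the chain's classical one (`hcl := Subsingleton.elim _ _`)
    [hdec : ∀ j, DecidableEq (PBond (F.P Kt) j)] (hcl : hdec = fun _ a b => Classical.propDecidable (a = b))
    (M₁ : ℕ) (Z Λ : ι → Set (Site (F.P Kt) 0)) (k : ι → ℕ) (M : ι → ℝ) (hk0 : ∀ i, 0 < k i) (hk : ∀ i, k i ≤ (F.P Kt).m + (F.P Kt).K)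
    (eR : ι → ℝ) (heR : ∀ i, 0 < eR i)
    (T : ∀ i, Finset (PBond (F.P Kt) (k i)))
    (lo hi : ι → Fin (F.P Kt).d → ℤ) (n : ι → ℕ) (hn : ∀ i κ, hi i κ ≤ lo i κ + n i) (hN : ∀ i, n i + 2 < (F.P Kt).sitesPerDir (k i))
    (hbox : ∀ i, pts (k i) (Λ i) = (castSite '' Set.Icc (lo i) (hi i) : Set (Site (F.P Kt) (k i))))
    (hZ : ∀ i, (boxPlaqs (lo i - 1) (hi i + 1) : Set (Plaq (F.P Kt) (k i))) ⊆ plaqsInside (pts (k i) (Z i)))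
    (hTG0 : ∀ i, T i = (box (fun κ => (hi i κ - lo i κ + 1).toNat) (lo i)).image fun x =>
      (⟨castSite (x - unitVec ⟨0, h0⟩), ⟨0, h0⟩⟩ : PBond (F.P Kt) (k i)))
    (hN5 : ∀ i κ, ((hi i κ - lo i κ + 1).toNat : ℤ) + 5 < (F.P Kt).sitesPerDir (k i))
    (K : ι → ℕ) (hK1 : ∀ i, 1 ≤ K i) (hKn : ∀ i κ, (hi i κ - lo i κ + 1).toNat ≤ K i)
    (ext : ∀ i, GaugeField (F.P Kt) (k i) SU2 → GaugeField (F.P Kt) (k i) SU2)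
    (hext : ∀ i Vk, ext i Vk = extend (pts (k i) (Λ i)) (shellGauge Vk (lo i) (hi i)) Vk)
    (hlohi : ∀ i, lo i ≤ hi i)
    {γ cJ bx : ℝ} (hγ : 0 < γ) (hcJ : 0 ≤ cJ) (hbx : 0 ≤ bx)
    (hbxM : ∀ i, 12 * ((F.P Kt).d : ℝ) * ((n i : ℝ) + 2) ^ 2 ≤ bx * (M i) ^ 2)
    {Cerr R 𝓐 : ι → ℝ} (hM : ∀ i, 1 ≤ (M i)) (hR : ∀ i, 0 < R i) (h𝓐 : ∀ i, 0 ≤ 𝓐 i)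
    (n' : ι → ℕ) (hn' : ∀ i, 1 ≤ n' i)
    -- (J1) the JOINT holomorphic extension of print's function in the datum perturbation and the field
    (hGj : ∀ i Vk, PlaqSmallOn (plaqsInside (pts (k i) (Z i ∩ (Λ i)ᶜ))) (eR i) Vk →
      ∃ 𝒢 : VecField (F.P Kt) (k i) (EuclideanSpace ℂ (Fin 3)) × VecField (F.P Kt) (k i) (EuclideanSpace ℂ (Fin 3)) → ℂ,
        DifferentiableOn ℂ 𝒢 (ball 0 (R i)) ∧
        (∀ z ∈ ball (0 : VecField (F.P Kt) (k i) (EuclideanSpace ℂ (Fin 3)) × VecField (F.P Kt) (k i) (EuclideanSpace ℂ (Fin 3))) (R i), ‖𝒢 z‖ ≤ 𝓐 i) ∧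
        ∀ p B' : VecField (F.P Kt) (k i) E3, ‖p‖ < R i → ‖B'‖ < R i →
          𝒢 (cplxVec p, cplxVec B') =
            ((fun177std (Node00.bgMSCoPOfRecord F 2 ν Kt kr Ω) M₁ (Z i) (k i) (expMul su2Chart B' (ext i (expMul su2Chart p Vk))) : ℝ) : ℂ))
    -- (L2) (1.7)–(1.9) p.358 for the Hessian of the slice function at `0`
    (hlead : ∀ i Vk, PlaqSmallOn (plaqsInside (pts (k i) (Z i ∩ (Λ i)ᶜ))) (eR i) Vk →
      ∀ X : GaugeSlice (pts (k i) (Λ i)) (T i) E3,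
      |⟪X, (fderiv ℝ (rGrad (pts (k i) (Λ i)) (T i)
              (sliceFn (pts (k i) (Λ i)) (T i) (fun177std (Node00.bgMSCoPOfRecord F 2 ν Kt kr Ω) M₁ (Z i) (k i)) (ext i Vk))) 0) X⟫ -
          ∑ a : Fin 3, formDk (n' i) (fun _ : Fin (F.P Kt).d => (F.P Kt).sitesPerDir (k i))
            (ofRealCfg (fun _ : Fin (F.P Kt).d => (F.P Kt).sitesPerDir (k i)) fun j =>
              ιA (pts (k i) (Λ i)) (T i) X ⟨j.1, j.2⟩ a)| ≤ Cerr i * ‖X‖ ^ 2)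
    (hsm : ∀ i, Cerr i ≤ (4 / Real.pi ^ 2) ^ ((F.P Kt).d + 2) / (2 * (3 * (K i : ℝ) ^ 2 + 2 * (K i : ℝ) ^ 4)))
    (hγle : ∀ i, γ / (M i) ^ 5 ≤ (4 / Real.pi ^ 2) ^ ((F.P Kt).d + 2) / (2 * (3 * (K i : ℝ) ^ 2 + 2 * (K i : ℝ) ^ 4)))
    -- the geometric letter: the k-blocks over the bonds meeting `Λ^{(k)}` lie inside `Ω₁(Z)` (print: `Λ` deep inside `Z`)
    (hfar : ∀ i (b : PBond (F.P Kt) 0), b.src ∉ maxDomT M₁ (Z i) 1 →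
      (⟨blockIter (k i) b.src, b.dir⟩ : PBond (F.P Kt) (k i)) ∉ bondsOf (pts (k i) (Λ i)))
    -- (Vn) the NEAR-FIELD part of (1.77) at the extended regular datum is small (replaces (L3))
    {cA : ℝ}
    (hVn : ∀ i ε Vk, 0 < ε → ε ≤ eR i → PlaqSmallOn (plaqsInside (pts (k i) (Z i ∩ (Λ i)ᶜ))) ε Vk →
      wilsonLoc ((plaqsOf (maxDomT M₁ (Z i) 1)).indicator fun _ => (1 : ℝ))
        (bgKZstd (Node00.bgMSCoPOfRecord F 2 ν Kt kr Ω) M₁ (Z i) (k i) (ext i Vk)) ≤ cA * ε ^ 2)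
    (hcJ' : ∀ i, 2 * cA * eR i / R i + 4 * 𝓐 i / (R i * eR i) ≤ cJ)
    : ∃ a₁ : ι → ℝ, (∀ i, 0 < a₁ i) ∧
      B15.Prop1Printed (lfVarOn su2Chart fun i => InstOn.std (Node00.bgMSCoPOfRecord F 2 ν Kt kr Ω) M₁ (Z i) (Λ i) (k i) (M i) (a₁ i)
        (anExt (pts (k i) (Λ i)) (T i) (fun177std (Node00.bgMSCoPOfRecord F 2 ν Kt kr Ω) M₁ (Z i) (k i)) (ext i)
          (min (1 / 2) (min (R i / 8) (γ / (M i) ^ 5 * (R i / 2) ^ 2 / (48 * (4 * 𝓐 i / R i + 1))))))) := by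
  subst hcl
  exact exists_domain_prop1Printed_lfVarOn_std_su2_box_intrinsic_analytic_ofRecord_ofNearValue hd3 h0 (Node00.avOfRecord F 2 Kt)
    (gaugeAct_mem_regMSCoPOfRecord ν Kt kr Ω) M₁ Z Λ k M hk0 hk eR heR T lo hi n hn hN hbox hZ hTG0 hN5 K hK1 hKn ext hext hlohi hγ hcJ
    hbx hbxM hM hR h𝓐 n' hn' hGj hlead hsm hγle hfar hVn hcJ'

end Record

end Literature.MathematicalPhysics.QuantumFieldTheory.Balaban1983to89.B15Prop1GradientFromNearValueAtCoPRecord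

end
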